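import Summits.KontsevichZagierPeriods.KontsevichZagierPeriods.Theses.IsogenyCertificates

/-!
# Sketch (ideator 2, crux stmt-KontsevichZagierPeriods-10663 `XMapKernel`, round 1)

First lemmas of the two idea cards `isogeny-orbit-collapse` and `derived-datum-quasi-periods`,
typed over existing declarations (Mathlib + the summit's KZ calculus + the route file). Nothing here
is an item; `def … : Prop` only, plus two checked calibrations and the trivial direction
`XMapKernel → cell`.

The generating set `gens = moves ∪ xMapRel` is copied verbatim from the standing disprover's
`Cruxes/XMapKernel/Disproof.lean` §0 (not importable from a session folder).
-/

noncomputable section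

set_option linter.dupNamespace false

namespace Summit.KontsevichZagierPeriods.KontsevichZagierPeriods.Cruxes.XMapKernel.Ideator2

open Literature.NumberTheory.Transcendental
open Summit.KontsevichZagierPeriods.KontsevichZagierPeriods.Theses.IsogenyCertificates
open Set MeasureTheory

/-! ## §0 Vocabulary (copied from Disproof.lean §0) -/

/-- The x-map period relators (fifth generating set of the crux), verbatim. -/
def xMapRel : Set KZ.FormalRep :=
  {d | ∃ (A B A' B' : ℤ) (f g : Polynomial ℚ) (c a b : ℚ) (r r' : KZ.IntegralRep 1),
    4 * A ^ 3 + 27 * B ^ 2 ≠ 0 ∧ 4 * A' ^ 3 + 27 * B' ^ 2 ≠ 0 ∧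
    Polynomial.derivative f * g - f * Polynomial.derivative g ≠ 0 ∧
    Polynomial.C (c ^ 2) * g * (f ^ 3 + Polynomial.C (A' : ℚ) * f * g ^ 2 + Polynomial.C (B' : ℚ) * g ^ 3) =
      (Polynomial.X ^ 3 + Polynomial.C (A : ℚ) * Polynomial.X + Polynomial.C (B : ℚ)) *
        (Polynomial.derivative f * g - f * Polynomial.derivative g) ^ 2 ∧
    0 < a ∧ 0 < b ∧
    r.domain = {x | 0 < x 0 ^ 3 + (A : ℝ) * x 0 + (B : ℝ)} ∧
    Set.EqOn r.integrand (fun x => (a : ℝ) / Real.sqrt (x 0 ^ 3 + (A : ℝ) * x 0 + (B : ℝ))) r.domain ∧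
    r'.domain = {x | 0 < x 0 ^ 3 + (A' : ℝ) * x 0 + (B' : ℝ)} ∧
    Set.EqOn r'.integrand (fun x => (b : ℝ) / Real.sqrt (x 0 ^ 3 + (A' : ℝ) * x 0 + (B' : ℝ))) r'.domain ∧
    r.value = r'.value ∧ d = KZ.of r - KZ.of r'}

/-- The four move sets. -/
def moves : Set KZ.FormalRep :=
  KZ.domainAddRel ∪ KZ.integrandAddRel ∪ KZ.changeOfVariablesRel ∪ KZ.newtonLeibnizRel

/-- The crux's generating set. -/
def gens : Set KZ.FormalRep := moves ∪ xMapRel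

/-- The crux, unfolded (definitional). -/
theorem xMapKernel_iff :
    XMapKernel ↔ ∀ c : KZ.FormalRep, KZ.eval c = 0 → c ∈ AddSubgroup.closure gens := Iff.rfl

/-! ## §1 Data, loci, periods -/

/-- The x-rational isogeny datum of the route (direction `(A,B) → (A',B')`). -/
def IsDatum (A B A' B' : ℤ) (f g : Polynomial ℚ) (c : ℚ) : Prop :=
  Polynomial.derivative f * g - f * Polynomial.derivative g ≠ 0 ∧
  Polynomial.C (c ^ 2) * g * (f ^ 3 + Polynomial.C (A' : ℚ) * f * g ^ 2 + Polynomial.C (B' : ℚ) * g ^ 3) =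
    (Polynomial.X ^ 3 + Polynomial.C (A : ℚ) * Polynomial.X + Polynomial.C (B : ℚ)) *
      (Polynomial.derivative f * g - f * Polynomial.derivative g) ^ 2

/-- Two short Weierstrass cubics over `ℤ` are joined by SOME datum. -/
def DatumRel (A B A' B' : ℤ) : Prop := ∃ (f g : Polynomial ℚ) (c : ℚ), IsDatum A B A' B' f g c

/-- Nonsingularity `4A³ + 27B² ≠ 0`. -/
def Nonsing (A B : ℤ) : Prop := 4 * A ^ 3 + 27 * B ^ 2 ≠ 0

/-- The cubic `x³ + Ax + B` as a real function. -/
def cubic (A B : ℤ) (x : ℝ) : ℝ := x ^ 3 + (A : ℝ) * x + (B : ℝ)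

/-- `{P > 0} ⊆ ℝ¹`: the x-range of `E(ℝ)`. -/
def posLocus (A B : ℤ) : Set (Fin 1 → ℝ) := {x | 0 < cubic A B (x 0)}

/-- The egg (bounded component of `{P > 0}`, empty unless three real roots). -/
def egg (A B : ℤ) : Set (Fin 1 → ℝ) := {x | 0 < cubic A B (x 0) ∧ ∃ t : ℝ, x 0 < t ∧ cubic A B t < 0}

/-- The full real period `Ω(A,B) = ∫_{P>0} dx/√P`. -/
def realPeriod (A B : ℤ) : ℝ := ∫ x in posLocus A B, 1 / Real.sqrt (cubic A B (x 0))

/-! ## §2 Card `isogeny-orbit-collapse` -/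

/-- Generators of the cell: `[{P>0}, a/√P]`, `a ∈ ℚ` (any sign), `(A,B) ∈ ℤ²` nonsingular. -/
def realPeriodGen : Set KZ.FormalRep :=
  {d | ∃ (A B : ℤ) (a : ℚ) (r : KZ.IntegralRep 1), Nonsing A B ∧ r.domain = posLocus A B ∧
      EqOn r.integrand (fun x => (a : ℝ) / Real.sqrt (cubic A B (x 0))) r.domain ∧ d = KZ.of r}

/-- ORBIT COLLAPSE (value shadow of the transfer; real analysis only): along a datum the two full
real periods have a positive RATIONAL ratio (`= k n″/(|c| n′)`, counted by sheets). -/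
def OrbitCollapse : Prop :=
  ∀ (A B A' B' : ℤ), Nonsing A B → Nonsing A' B' → DatumRel A B A' B' →
    ∃ q : ℚ, 0 < q ∧ realPeriod A B = q * realPeriod A' B'

/-- The transcendence input, datum form (Huber–Wüstholz two/many-curve + Masser-CM + twists +
"isogeny ⇒ datum"): real periods of pairwise datum-UNRELATED nonsingular integral cubics are
`ℚ`-linearly independent. -/
def RealPeriodIndependence : Prop :=
  ∀ (k : ℕ) (A B : Fin k → ℤ) (q : Fin k → ℚ),
    (∀ i, Nonsing (A i) (B i)) → (∀ i j, i ≠ j → ¬ DatumRel (A i) (B i) (A j) (B j)) →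
    ∑ i, (q i : ℝ) * realPeriod (A i) (B i) = 0 → ∀ i, q i = 0

/-- The cell of the crux where the free relators pay: kernel elements supported on
`realPeriodGen` lie in `closure gens` — WITHOUT `XMapPeriodTransfer`. -/
def RealPeriodCellKernel : Prop :=
  ∀ c ∈ AddSubgroup.closure realPeriodGen, KZ.eval c = 0 → c ∈ AddSubgroup.closure gens

/-- FIRST LEMMA (card A): orbit collapse + independence ⇒ the real-period cell of `XMapKernel`.
Pure algebra over the free relators `xMapRel` and integrand additivity. -/
def RealPeriodOrbitKernel : Prop := OrbitCollapse → RealPeriodIndependence → RealPeriodCellKernel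

/-- The cell is a literal restriction of the crux. -/
theorem realPeriodCellKernel_of_xMapKernel (h : XMapKernel) : RealPeriodCellKernel :=
  fun c _ hc => h c hc

/-- Sanity: the identity datum joins a cubic to itself (`f = X`, `g = 1`, `c = 1`). -/
theorem datumRel_refl (A B : ℤ) : DatumRel A B A B := by
  refine ⟨Polynomial.X, 1, 1, ?_, ?_⟩
  · simp
  · simp

/-! ## §3 Card `derived-datum-quasi-periods` -/

/-- DERIVED DATUM IDENTITY (first lemma of card B, pure polynomial algebra): for every datum there
are `α β ∈ ℚ`, `u ∈ ℚ[X]`, `m ∈ ℕ` with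
`2c·f·g^m = 2(α + βX)·g^{m+1} + 2(u′g − m u g′)·P + u g·P′`,
i.e. `c·R dx/y = (α dx + β x dx)/y + d(S·y)` with `R = f/g`, `S = u/g^m` — the pull-back of the
quasi-period form `X dX/Y` is `αω + βη +` exact, with a RATIONAL certificate `S`. -/
def DerivedDatum : Prop :=
  ∀ (A B A' B' : ℤ) (f g : Polynomial ℚ) (c : ℚ), IsDatum A B A' B' f g c →
    ∃ (α β : ℚ) (u : Polynomial ℚ) (m : ℕ),
      Polynomial.C (2 * c) * f * g ^ m =
        2 * (Polynomial.C α + Polynomial.C β * Polynomial.X) * g ^ (m + 1)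
        + 2 * (Polynomial.derivative u * g - Polynomial.C (m : ℚ) * u * Polynomial.derivative g)
            * (Polynomial.X ^ 3 + Polynomial.C (A : ℚ) * Polynomial.X + Polynomial.C (B : ℚ))
        + u * g * Polynomial.derivative
            (Polynomial.X ^ 3 + Polynomial.C (A : ℚ) * Polynomial.X + Polynomial.C (B : ℚ))

/-- Calibration of `IsDatum` on the lemniscate 2-isogeny `y² = x³ − x → Y² = X³ + 4X`,
`(f, g, c) = (X² − 1, X, 1)` (the route's `LemniscateTwoIsogeny` datum). -/
theorem isDatum_lemniscate : IsDatum (-1) 0 4 0 (Polynomial.X ^ 2 - 1) Polynomial.X 1 := by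
  constructor
  · intro h
    have := congrArg (Polynomial.eval 0) h
    simp at this
  · apply Polynomial.funext
    intro x
    simp [Polynomial.derivative_X_pow]
    ring

/-- Calibration of `DerivedDatum` on the same datum: `α = 0`, `β = 2 = N/c`, `u = −2`, `m = 1`,
i.e. `R dx/y = 2·x dx/y + d(−2y/x)` on `y² = x³ − x`. -/
theorem derivedDatum_lemniscate :
    Polynomial.C (2 * (1 : ℚ)) * (Polynomial.X ^ 2 - 1) * Polynomial.X ^ 1 =
      2 * (Polynomial.C (0 : ℚ) + Polynomial.C (2 : ℚ) * Polynomial.X) * Polynomial.X ^ (1 + 1)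
      + 2 * (Polynomial.derivative (Polynomial.C (-2 : ℚ)) * Polynomial.X
            - Polynomial.C ((1 : ℕ) : ℚ) * Polynomial.C (-2 : ℚ) * Polynomial.derivative Polynomial.X)
          * (Polynomial.X ^ 3 + Polynomial.C ((-1 : ℤ) : ℚ) * Polynomial.X + Polynomial.C ((0 : ℤ) : ℚ))
      + Polynomial.C (-2 : ℚ) * Polynomial.X * Polynomial.derivative
          (Polynomial.X ^ 3 + Polynomial.C ((-1 : ℤ) : ℚ) * Polynomial.X + Polynomial.C ((0 : ℤ) : ℚ)) := by
  apply Polynomial.funext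
  intro x
  simp [Polynomial.derivative_X_pow]
  ring

/-- QUASI-PERIOD X-MAP TRANSFER (engine statement of card B; egg → egg′, `g` pole-free on the closed
egg): the egg integrals of `(b₀ + b₁X) dX/√Q` are KZ-equivalent to egg integrals of some
`(a₀ + a₁x) dx/√P` with RATIONAL `a₀, a₁` (sheets of `R` by rule 2, integrand additivity, and ONE
Newton–Leibniz move with the Hermite primitive `S·√P`, which vanishes at the egg's endpoints). -/
def QuasiPeriodXMapTransfer : Prop :=
  ∀ (A B A' B' : ℤ) (f g : Polynomial ℚ) (c : ℚ),
    4 * A ^ 3 + 27 * B ^ 2 < 0 → 4 * A' ^ 3 + 27 * B' ^ 2 < 0 → IsDatum A B A' B' f g c →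
    (∀ x : ℝ, 0 ≤ cubic A B x → (∃ t : ℝ, x < t ∧ cubic A B t < 0) →
      (g.map (algebraMap ℚ ℝ)).eval x ≠ 0) →
    ∀ (b₀ b₁ : ℚ), ∃ (a₀ a₁ : ℚ), ∀ (r r' : KZ.IntegralRep 1),
      r.domain = egg A B →
      EqOn r.integrand (fun x => ((a₀ : ℝ) + (a₁ : ℝ) * x 0) / Real.sqrt (cubic A B (x 0))) r.domain →
      r'.domain = egg A' B' →
      EqOn r'.integrand (fun x => ((b₀ : ℝ) + (b₁ : ℝ) * x 0) / Real.sqrt (cubic A' B' (x 0))) r'.domain →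
      KZ.Equivalent r r'

/-- Generators of the `(ω, η)` cell: egg integrals `[(egg), (a₀ + a₁x)/√P]`, `aᵢ ∈ ℚ`, three real
roots. -/
def quasiPeriodGen : Set KZ.FormalRep :=
  {d | ∃ (A B : ℤ) (a₀ a₁ : ℚ) (r : KZ.IntegralRep 1), 4 * A ^ 3 + 27 * B ^ 2 < 0 ∧ r.domain = egg A B ∧
      EqOn r.integrand (fun x => ((a₀ : ℝ) + (a₁ : ℝ) * x 0) / Real.sqrt (cubic A B (x 0))) r.domain ∧
      d = KZ.of r}

/-- The `(ω, η)` cell of the crux (implied by the crux verbatim; card B proposes to prove it from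
`QuasiPeriodXMapTransfer`, intra-curve Hermite reduction and the 10-tuple independence
`HuberWustholzTwoCurvePeriods` / `masser_ellipticPeriods(_cm)`). -/
def QuasiPeriodCellKernel : Prop :=
  ∀ c ∈ AddSubgroup.closure quasiPeriodGen, KZ.eval c = 0 → c ∈ AddSubgroup.closure gens

theorem quasiPeriodCellKernel_of_xMapKernel (h : XMapKernel) : QuasiPeriodCellKernel :=
  fun c _ hc => h c hc

end Summit.KontsevichZagierPeriods.KontsevichZagierPeriods.Cruxes.XMapKernel.Ideator2
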